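import Mathlib
import Summits.NavierStokesRegularity.NavierStokesRegularity.Theorems.FilamentSkeletonRssSkeletonJ1LSingleDatum
import Summits.NavierStokesRegularity.NavierStokesRegularity.Theorems.FilamentSkeletonRssMatchedKernelSymmetryTransport
import Summits.NavierStokesRegularity.NavierStokesRegularity.Theorems.FilamentSkeletonRssTangentSkeletonNearStraightGeometryBlock
import Summits.NavierStokesRegularity.NavierStokesRegularity.Theorems.FilamentSkeletonRssSkeletonEquilibriumKernelIntegrable

/-!
# `SkeletonJ1L` (stmt-NavierStokesRegularity-23296) from ONE CURVE in the `R_π`-symmetric class (+ the clause-13 child):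
# the symmetric-class construction (strategist S⁺8) made a by-name reduction

After `Theorems.TangentSkeletonLCurveCore` (p837172: unit cores discharge every area clause of the heart ⟨23320⟩), `Theorems.SkeletonJ1LSingleDatum`
(p837299: the parent needs the heart at the ONE landed `R_π`-symmetric pair `γ ≡ 125π/108`, `α = 875/432`) and `Theorems.MatchedKernelSymmetryTransport`
(p837386: `u(Mx + c)ᵢ = κ sᵢ u(x)ᵢ` for cored kernels), this file closes the loop: in the symmetric class `X₁ = R_π ∘ X₀` (`R_π = diag(−1,−1,1)`, the
half-turn about `e₃`; equal circulations; `w₁ = w₀`, `c₁ = c₀`) the whole frame field is `R_π`-equivariant (`κ = 1`, compatible class), so EVERY clause of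
filament `1` is the transported clause of filament `0`:
* `norm_eq_of_halfTurn`, `halfTurn_eq`, `contDiff_halfTurn`, `deriv_halfTurn`, `deriv_deriv_halfTurn` — coordinate bookkeeping of the class;
* `field_halfTurn` — for the pair's unit-core field `v = u_X + ½y − α e₃×y`: `v(R_π y)ᵢ = sᵢ v(y)ᵢ` (integrability clause at every `(k, y)`);
* ★ `pairClauses_of_halfTurnSymmetric` — the twelve curve clauses of the PAIR (the matrix of `skeletonJ1L_of_pairCurveCore`'s (h1) at one `Γ`) from:
  the geometry of `X₀` alone (C², unit speed, curvature, properness, chord–arc, escape, waist, tilt, box), the separation of `X₀` from its image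
  `R_π X₀`, the slip `w₀` with its zero clause, and the TWO dynamic clauses of filament `0` only (`w₀ = ⟪v(X₀), X₀′⟫`, exact tangency on the ball);
* ★ `skeletonJ1L_of_halfTurnSymmetricCore` — `Theses.FilamentSkeletonRss.SkeletonJ1L` BY NAME from a ONE-CURVE symmetric core family and
  `Theses.FilamentSkeletonRss.Clause13NearStraightL` (⟨23322⟩ already discharged in p837299).
So the parent's open ∃-content is: ONE proper near-straight `C²` curve, exactly tangent on the ball to the field generated by itself and its half-turn image,
with a unique supercritical slip zero — plus the clause-13 child.
HONEST FRAMING: bookkeeping (symmetry transport + logic) about a HYPOTHETICAL filament skeleton on the NEGATIVE side of a MODEL route; no registered stub,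
child or parent is proved; nothing bears on Navier–Stokes regularity or blow-up.  `--supports stmt-NavierStokesRegularity-23296`. [folklore]
-/

set_option linter.dupNamespace false

noncomputable section

namespace Summit.NavierStokesRegularity.NavierStokesRegularity.Theorems.SkeletonJ1LSymmetricPair

open Filter MeasureTheory
open scoped InnerProductSpace BigOperators Topology
open Literature.Analysis.FluidPDE
open Summit.NavierStokesRegularity.NavierStokesRegularity.Theorems.MatchedKernelSymmetryTransport (induction_apply_symm frame_apply_halfTurn)
open Summit.NavierStokesRegularity.NavierStokesRegularity.Theorems.SkeletonJ1LSingleDatum (skeletonJ1L_of_pairCurveCore)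

/-! ## §1 Coordinate bookkeeping of the half-turn class -/

/-- `‖v‖²` in coordinates. [folklore] -/
private theorem sp_norm_sq_fin3 (v : EuclideanSpace ℝ (Fin 3)) : ‖v‖ ^ 2 = v 0 ^ 2 + v 1 ^ 2 + v 2 ^ 2 := by
  rw [EuclideanSpace.norm_sq_eq]
  simp [Fin.sum_univ_three, Real.norm_eq_abs, sq_abs]

/-- `⟪v, w⟫ = Σ vᵢwᵢ` in `ℝ³`. [folklore] -/
private theorem sp_inner_fin3 (v w : EuclideanSpace ℝ (Fin 3)) : ⟪v, w⟫_ℝ = v 0 * w 0 + v 1 * w 1 + v 2 * w 2 := by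
  simp only [PiLp.inner_apply, RCLike.inner_apply, conj_trivial, Fin.sum_univ_three]
  ring

/-- Norm invariance under the half-turn: `p′ = R_π p` (coordinates) ⇒ `‖p′‖ = ‖p‖`. [folklore] -/
theorem norm_eq_of_halfTurn {p p' : EuclideanSpace ℝ (Fin 3)} (h : p' 0 = -p 0 ∧ p' 1 = -p 1 ∧ p' 2 = p 2) : ‖p'‖ = ‖p‖ := by
  have h2 : ‖p'‖ ^ 2 = ‖p‖ ^ 2 := by
    rw [sp_norm_sq_fin3, sp_norm_sq_fin3, h.1, h.2.1, h.2.2]; ring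
  nlinarith [norm_nonneg p', norm_nonneg p]

/-- Difference version: `‖R_π p − R_π q‖ = ‖p − q‖` and the mixed form `‖R_π p − q‖ = ‖p − R_π q‖`. [folklore] -/
theorem norm_sub_eq_of_halfTurn {p p' q q' : EuclideanSpace ℝ (Fin 3)} (hp : p' 0 = -p 0 ∧ p' 1 = -p 1 ∧ p' 2 = p 2)
    (hq : q' 0 = -q 0 ∧ q' 1 = -q 1 ∧ q' 2 = q 2) : ‖p' - q'‖ = ‖p - q‖ ∧ ‖p' - q‖ = ‖p - q'‖ := by
  constructor
  · refine norm_eq_of_halfTurn ⟨?_, ?_, ?_⟩ <;>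
      simp only [PiLp.sub_apply, hp.1, hp.2.1, hp.2.2, hq.1, hq.2.1, hq.2.2] <;> ring
  · refine norm_eq_of_halfTurn ⟨?_, ?_, ?_⟩ <;>
      simp only [PiLp.sub_apply, hp.1, hp.2.1, hp.2.2, hq.1, hq.2.1, hq.2.2] <;> ring

/-- The half-turn image as a formula: `R_π y = −y + 2 y₂ e₃`. [folklore] -/
theorem halfTurn_eq {X : Fin 2 → ℝ → EuclideanSpace ℝ (Fin 3)}
    (hsym : ∀ σ, X 1 σ 0 = -X 0 σ 0 ∧ X 1 σ 1 = -X 0 σ 1 ∧ X 1 σ 2 = X 0 σ 2) :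
    X 1 = fun σ => -(X 0 σ) + (2 * X 0 σ 2) • EuclideanSpace.single (2 : Fin 3) (1 : ℝ) := by
  funext σ
  ext i
  fin_cases i
  · simp [(hsym σ).1]
  · simp [(hsym σ).2.1]
  · simp [(hsym σ).2.2]; ring

/-- `C^n` transport: `X₀ ∈ C^n ⇒ X₁ = R_π X₀ ∈ C^n`. [folklore] -/
theorem contDiff_halfTurn {X : Fin 2 → ℝ → EuclideanSpace ℝ (Fin 3)} {n : WithTop ℕ∞}
    (hsym : ∀ σ, X 1 σ 0 = -X 0 σ 0 ∧ X 1 σ 1 = -X 0 σ 1 ∧ X 1 σ 2 = X 0 σ 2) (h0 : ContDiff ℝ n (X 0)) :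
    ContDiff ℝ n (X 1) := by
  rw [halfTurn_eq hsym]
  have hc : ContDiff ℝ n (fun σ => X 0 σ 2) :=
    (EuclideanSpace.proj (2 : Fin 3) : EuclideanSpace ℝ (Fin 3) →L[ℝ] ℝ).contDiff.comp h0
  exact h0.neg.add ((contDiff_const.mul hc).smul contDiff_const)

/-- The symmetry in the letters of `Theorems.SkeletonEquilibrium.SymmetryRigidity` / `Theorems.MatchedKernelSymmetryTransport`: `π = swap`, `ε = 1`,
`s = (−1,−1,1)`, `c = 0`. [folklore] -/
theorem hsym_letters {X : Fin 2 → ℝ → EuclideanSpace ℝ (Fin 3)}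
    (hsym : ∀ σ, X 1 σ 0 = -X 0 σ 0 ∧ X 1 σ 1 = -X 0 σ 1 ∧ X 1 σ 2 = X 0 σ 2) :
    ∀ k σ i, X ((![1, 0] : Fin 2 → Fin 2) k) ((1:ℝ) * σ) i = (![-1, -1, 1] : Fin 3 → ℝ) i * X k σ i + (0 : Fin 3 → ℝ) i := by
  intro k σ i
  rw [one_mul]
  obtain ⟨h0, h1, h2⟩ := hsym σ
  fin_cases k <;> fin_cases i <;> simp [h0, h1, h2]

/-- Velocity transport in the class: `X₁′(σ)ᵢ = sᵢ X₀′(σ)ᵢ` (and symmetrically). [folklore] -/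
theorem deriv_halfTurn {X : Fin 2 → ℝ → EuclideanSpace ℝ (Fin 3)}
    (hsym : ∀ σ, X 1 σ 0 = -X 0 σ 0 ∧ X 1 σ 1 = -X 0 σ 1 ∧ X 1 σ 2 = X 0 σ 2) (hd : ∀ k, Differentiable ℝ (X k)) (σ : ℝ) :
    deriv (X 1) σ 0 = -deriv (X 0) σ 0 ∧ deriv (X 1) σ 1 = -deriv (X 0) σ 1 ∧ deriv (X 1) σ 2 = deriv (X 0) σ 2 := by
  have h := fun i => SkeletonEquilibrium.SymmetryRigidity.deriv_apply_symm (Ξ := X) (π := ![1, 0]) (s := ![-1, -1, 1])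
    (c := (0 : Fin 3 → ℝ)) (ε := 1) hd (by norm_num) (hsym_letters hsym) 0 σ i
  simp only [one_mul] at h
  have e0 := h 0; have e1 := h 1; have e2 := h 2
  simp at e0 e1 e2
  exact ⟨e0, e1, e2⟩

/-- Second derivatives in the class (`X ∈ C²`): `X₁″(σ)ᵢ = sᵢ X₀″(σ)ᵢ`. [folklore] -/
theorem deriv_deriv_halfTurn {X : Fin 2 → ℝ → EuclideanSpace ℝ (Fin 3)}
    (hsym : ∀ σ, X 1 σ 0 = -X 0 σ 0 ∧ X 1 σ 1 = -X 0 σ 1 ∧ X 1 σ 2 = X 0 σ 2) (hC : ∀ k, ContDiff ℝ 2 (X k)) (σ : ℝ) :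
    deriv (deriv (X 1)) σ 0 = -deriv (deriv (X 0)) σ 0 ∧ deriv (deriv (X 1)) σ 1 = -deriv (deriv (X 0)) σ 1 ∧
      deriv (deriv (X 1)) σ 2 = deriv (deriv (X 0)) σ 2 := by
  have hd : ∀ k, Differentiable ℝ (X k) := fun k => (hC k).differentiable (by norm_num)
  have hdd : ∀ k, Differentiable ℝ (deriv (X k)) := fun k => by
    have := (hC k).differentiable_iteratedDeriv 1 (by norm_num)
    rwa [iteratedDeriv_one] at this
  -- the first derivatives form a pair in the same class
  have hsym' : ∀ τ, deriv (X 1) τ 0 = -deriv (X 0) τ 0 ∧ deriv (X 1) τ 1 = -deriv (X 0) τ 1 ∧ deriv (X 1) τ 2 = deriv (X 0) τ 2 :=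
    fun τ => deriv_halfTurn hsym hd τ
  exact deriv_halfTurn (X := fun k => deriv (X k)) hsym' hdd σ

/-! ## §2 The field is `R_π`-equivariant on the symmetric pair -/

/-- **Field transport.**  For the symmetric pair with equal circulation parameters and the unit-core kernel, the frame field
`v y = u X y + ½ y − α e₃ × y` satisfies `v(R_π y)ᵢ = sᵢ v(y)ᵢ` (integrability clause of the induction at every `(k, y)`). [folklore] -/
theorem field_halfTurn {X : Fin 2 → ℝ → EuclideanSpace ℝ (Fin 3)} {Γ γ₀ α a : ℝ}
    (hsym : ∀ σ, X 1 σ 0 = -X 0 σ 0 ∧ X 1 σ 1 = -X 0 σ 1 ∧ X 1 σ 2 = X 0 σ 2) (hd : ∀ k, Differentiable ℝ (X k))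
    (hint : ∀ k (x : EuclideanSpace ℝ (Fin 3)), Integrable (fun σ : ℝ =>
      ((‖x - X k σ‖ ^ 2 + a) ^ (3 / 2 : ℝ))⁻¹ • cross (deriv (X k) σ) (x - X k σ)))
    {u : (Fin 2 → ℝ → EuclideanSpace ℝ (Fin 3)) → EuclideanSpace ℝ (Fin 3) → EuclideanSpace ℝ (Fin 3)}
    {v : EuclideanSpace ℝ (Fin 3) → EuclideanSpace ℝ (Fin 3)}
    (hu : ∀ Z y, u Z y = ∑ k, (Γ*((fun _ : Fin 2 => γ₀) k)/(4*Real.pi))•∫ σ:ℝ, ((‖y-Z k σ‖^2+a)^(3/2:ℝ))⁻¹•cross (deriv (Z k) σ) (y-Z k σ))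
    (hv : ∀ y, v y = u X y+(1/2:ℝ)•y-α•cross (EuclideanSpace.single 2 1) y)
    (y y' : EuclideanSpace ℝ (Fin 3)) (hy : y' 0 = -y 0 ∧ y' 1 = -y 1 ∧ y' 2 = y 2) :
    v y' 0 = -v y 0 ∧ v y' 1 = -v y 1 ∧ v y' 2 = v y 2 := by
  have hy' : ∀ i, y' i = (![-1, -1, 1] : Fin 3 → ℝ) i * y i + (0 : Fin 3 → ℝ) i := by
    intro i; fin_cases i <;> simp [hy.1, hy.2.1, hy.2.2]
  have hsgn : (1:ℝ) * ((![-1, -1, 1] : Fin 3 → ℝ) 0 * (![-1, -1, 1] : Fin 3 → ℝ) 1 * (![-1, -1, 1] : Fin 3 → ℝ) 2) = 1 := by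
    simp
  -- transport of the induction, in the letters of `induction_apply_symm` (cores `A ≡ a`)
  have key : ∀ i, (u X y') i = (![-1, -1, 1] : Fin 3 → ℝ) i * (u X y) i := by
    intro i
    have h : (∑ k : Fin 2, (Γ * (fun _ : Fin 2 => γ₀) k / (4 * Real.pi)) • ∫ σ : ℝ,
        ((‖y' - X k σ‖ ^ 2 + (fun (_ : Fin 2) (_ : ℝ) => a) k σ) ^ (3 / 2 : ℝ))⁻¹ • cross (deriv (X k) σ) (y' - X k σ)) i =
        1 * ((![-1, -1, 1] : Fin 3 → ℝ) 0 * (![-1, -1, 1] : Fin 3 → ℝ) 1 * (![-1, -1, 1] : Fin 3 → ℝ) 2) *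
          (![-1, -1, 1] : Fin 3 → ℝ) i *
        (∑ k : Fin 2, (Γ * (fun _ : Fin 2 => γ₀) k / (4 * Real.pi)) • ∫ σ : ℝ,
          ((‖y - X k σ‖ ^ 2 + (fun (_ : Fin 2) (_ : ℝ) => a) k σ) ^ (3 / 2 : ℝ))⁻¹ • cross (deriv (X k) σ) (y - X k σ)) i :=
      induction_apply_symm (Ξ := X) (A := fun _ _ => a) (π := ![1, 0]) (s := ![-1, -1, 1]) (c := (0 : Fin 3 → ℝ)) (ε := 1)
        hd (by intro i; fin_cases i <;> simp) (by norm_num) (hsym_letters hsym) (by intro k σ; rfl)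
        (by intro k; fin_cases k <;> rfl) (fun _ : Fin 2 => γ₀) (fun _ => rfl) Γ hint y y' hy' i
    have e1 : u X y' = ∑ k : Fin 2, (Γ * (fun _ : Fin 2 => γ₀) k / (4 * Real.pi)) • ∫ σ : ℝ,
        ((‖y' - X k σ‖ ^ 2 + (fun (_ : Fin 2) (_ : ℝ) => a) k σ) ^ (3 / 2 : ℝ))⁻¹ • cross (deriv (X k) σ) (y' - X k σ) := hu X y'
    have e2 : u X y = ∑ k : Fin 2, (Γ * (fun _ : Fin 2 => γ₀) k / (4 * Real.pi)) • ∫ σ : ℝ,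
        ((‖y - X k σ‖ ^ 2 + (fun (_ : Fin 2) (_ : ℝ) => a) k σ) ^ (3 / 2 : ℝ))⁻¹ • cross (deriv (X k) σ) (y - X k σ) := hu X y
    rw [← e1, ← e2, hsgn, one_mul] at h
    exact h
  -- the frame part in coordinates
  have e3c : ∀ z : EuclideanSpace ℝ (Fin 3), cross (EuclideanSpace.single (2 : Fin 3) (1 : ℝ)) z 0 = -z 1 ∧
      cross (EuclideanSpace.single (2 : Fin 3) (1 : ℝ)) z 1 = z 0 ∧ cross (EuclideanSpace.single (2 : Fin 3) (1 : ℝ)) z 2 = 0 := by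
    intro z; refine ⟨?_, ?_, ?_⟩ <;> simp [cross, cross_apply]
  have expand : ∀ (z : EuclideanSpace ℝ (Fin 3)) (i : Fin 3),
      v z i = (u X z) i + (1/2 : ℝ) * z i - α * (cross (EuclideanSpace.single (2 : Fin 3) (1 : ℝ)) z) i := by
    intro z i; rw [hv z]; simp only [PiLp.add_apply, PiLp.sub_apply, PiLp.smul_apply, smul_eq_mul]
  obtain ⟨c0, c1, c2⟩ := e3c y
  obtain ⟨c0', c1', c2'⟩ := e3c y'
  have k0 := key 0
  have k1 := key 1
  have k2 := key 2
  simp at k0 k1 k2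
  refine ⟨?_, ?_, ?_⟩
  · rw [expand y' 0, expand y 0, k0, c0, c0', hy.1, hy.2.1]; ring
  · rw [expand y' 1, expand y 1, k1, c1, c1', hy.1, hy.2.1]; ring
  · rw [expand y' 2, expand y 2, k2, c2, c2', hy.2.2]


/-! ## §3 The pair's curve clauses from ONE curve in the class -/

/-- ★ **The twelve curve clauses of the symmetric PAIR from filament `0` alone.**  Class `X₁ = R_π X₀` (`hsym`), `w 1 = w 0`, `c 1 = c 0`, equal
circulation parameters `γ ≡ γ₀`; integrability clause of the unit-core induction at every `(k, y)`; geometry, box and zero clause of filament `0`;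
separation of `X₀` from `R_π X₀`; and the two DYNAMIC clauses of filament `0` (slip definition, exact tangency on the ball) for the pair's field. [folklore] -/
theorem pairClauses_of_halfTurnSymmetric {Γ γ₀ α δ ρ K Λ Rw Rb cg θ₀ : ℝ} {X : Fin 2 → ℝ → EuclideanSpace ℝ (Fin 3)}
    {w : Fin 2 → ℝ → ℝ} {c : Fin 2 → ℝ}
    (hsym : ∀ σ, X 1 σ 0 = -X 0 σ 0 ∧ X 1 σ 1 = -X 0 σ 1 ∧ X 1 σ 2 = X 0 σ 2) (hw1 : w 1 = w 0) (hc1 : c 1 = c 0)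
    (hint : ∀ k (x : EuclideanSpace ℝ (Fin 3)), Integrable (fun σ : ℝ =>
      ((‖x - X k σ‖ ^ 2 + Real.exp (-(1+Real.eulerMascheroniConstant-Real.log 2))) ^ (3 / 2 : ℝ))⁻¹ • cross (deriv (X k) σ) (x - X k σ)))
    (hα : α ≠ 0) (hγ : γ₀ ≠ 0) (hC : ContDiff ℝ 2 (X 0)) (hwd : Differentiable ℝ (w 0)) (hunit : ∀ τ, ‖deriv (X 0) τ‖ = 1)
    (hcurv : ∀ τ, ‖iteratedDeriv 2 (X 0) τ‖*√Γ≤K) (hprop : Tendsto (fun τ => ‖X 0 τ‖) (cocompact ℝ) atTop)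
    (hsep : ∀ τ σ, ρ*√Γ ≤ ‖X 0 τ - X 1 σ‖) (hca : ∀ τ σ, ρ*√Γ≤|τ-σ| → cg*ρ*√Γ≤‖X 0 τ-X 0 σ‖)
    (hesc : ∀ τ, cg*|τ-c 0|≤Rw*√Γ+‖X 0 τ‖) (hwaist : ‖X 0 (c 0)‖≤Rw*√Γ) (htilt : |⟪deriv (X 0) (c 0), EuclideanSpace.single 2 1⟫_ℝ|≤1-θ₀)
    (hbox : θ₀≤|α| ∧ |α|≤θ₀⁻¹ ∧ θ₀≤|γ₀| ∧ |γ₀|≤θ₀⁻¹)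
    (hzero : w 0 (c 0) = 0 ∧ (∀ τ, w 0 τ = 0 → τ = c 0) ∧ 3/2+δ≤deriv (w 0) (c 0) ∧ deriv (w 0) (c 0)≤Λ)
    (hdyn : ∀ (u : (Fin 2 → ℝ → EuclideanSpace ℝ (Fin 3)) → EuclideanSpace ℝ (Fin 3) → EuclideanSpace ℝ (Fin 3))
      (v : EuclideanSpace ℝ (Fin 3) → EuclideanSpace ℝ (Fin 3)),
      (∀ Z y, u Z y = ∑ k, (Γ*((fun _ : Fin 2 => γ₀) k)/(4*Real.pi))•∫ σ:ℝ, ((‖y-Z k σ‖^2+Real.exp (-(1+Real.eulerMascheroniConstant-Real.log 2)))^(3/2:ℝ))⁻¹•cross (deriv (Z k) σ) (y-Z k σ)) →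
      (∀ y, v y = u X y+(1/2:ℝ)•y-α•cross (EuclideanSpace.single 2 1) y) →
      (∀ τ, w 0 τ = ⟪v (X 0 τ), deriv (X 0) τ⟫_ℝ) ∧ (∀ τ, ‖X 0 τ‖≤Rb*√(Γ*Real.log Γ) → v (X 0 τ) = w 0 τ•deriv (X 0) τ)) :
            (∀ (u : (Fin 2 → ℝ → EuclideanSpace ℝ (Fin 3)) → EuclideanSpace ℝ (Fin 3) → EuclideanSpace ℝ (Fin 3))
              (v : EuclideanSpace ℝ (Fin 3) → EuclideanSpace ℝ (Fin 3)),
              (∀ Z y, u Z y = ∑ k, (Γ*((fun _ : Fin 2 => γ₀) k)/(4*Real.pi))•∫ σ:ℝ, ((‖y-Z k σ‖^2+Real.exp (-(1+Real.eulerMascheroniConstant-Real.log 2)))^(3/2:ℝ))⁻¹•cross (deriv (Z k) σ) (y-Z k σ)) →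
              (∀ y, v y = u X y+(1/2:ℝ)•y-α•cross (EuclideanSpace.single 2 1) y) →
              (α ≠ 0 ∧ (∀ j : Fin 2, (fun _ : Fin 2 => γ₀) j ≠ 0) ∧
               (∀ j, ContDiff ℝ 2 (X j) ∧ Differentiable ℝ (w j) ∧ (∀ τ, ‖deriv (X j) τ‖ = 1) ∧ (∀ τ, ‖iteratedDeriv 2 (X j) τ‖*√Γ≤K) ∧
                 Tendsto (fun τ => ‖X j τ‖) (cocompact ℝ) atTop) ∧
               (∀ j k, j ≠ k → ∀ τ σ, ρ*√Γ≤‖X j τ-X k σ‖) ∧ (∀ j τ σ, ρ*√Γ≤|τ-σ| → cg*ρ*√Γ≤‖X j τ-X j σ‖) ∧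
               (∀ j τ, cg*|τ-c j|≤Rw*√Γ+‖X j τ‖) ∧ (∀ j τ, w j τ = ⟪v (X j τ), deriv (X j) τ⟫_ℝ) ∧
               (∀ j τ, ‖X j τ‖≤Rb*√(Γ*Real.log Γ) → v (X j τ) = w j τ•deriv (X j) τ) ∧ (∀ j, ‖X j (c j)‖≤Rw*√Γ) ∧
               (∀ j, |⟪deriv (X j) (c j), EuclideanSpace.single 2 1⟫_ℝ|≤1-θ₀) ∧
               (θ₀≤|α| ∧ |α|≤θ₀⁻¹ ∧ ∀ j : Fin 2, θ₀≤|(fun _ : Fin 2 => γ₀) j| ∧ |(fun _ : Fin 2 => γ₀) j|≤θ₀⁻¹) ∧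
               (∀ j, w j (c j) = 0 ∧ (∀ τ, w j τ = 0 → τ = c j) ∧ 3/2+δ≤deriv (w j) (c j) ∧ deriv (w j) (c j)≤Λ))) := by
  -- regularity of both strands
  have hC1 : ContDiff ℝ 2 (X 1) := contDiff_halfTurn hsym hC
  have hCk : ∀ k, ContDiff ℝ 2 (X k) := Fin.forall_fin_two.mpr ⟨hC, hC1⟩
  have hd : ∀ k, Differentiable ℝ (X k) := fun k => (hCk k).differentiable (by norm_num)
  have hder := fun τ => deriv_halfTurn hsym hd τ
  have hdd := fun τ => deriv_deriv_halfTurn hsym hCk τ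
  have hit : ∀ k, iteratedDeriv 2 (X k) = deriv (deriv (X k)) := fun k => by
    rw [iteratedDeriv_eq_iterate]; rfl
  have hn : ∀ τ, ‖X 1 τ‖ = ‖X 0 τ‖ := fun τ => norm_eq_of_halfTurn (hsym τ)
  have hnd : ∀ τ σ, ‖X 1 τ - X 1 σ‖ = ‖X 0 τ - X 0 σ‖ ∧ ‖X 1 τ - X 0 σ‖ = ‖X 0 τ - X 1 σ‖ :=
    fun τ σ => norm_sub_eq_of_halfTurn (hsym τ) (hsym σ)
  have hin : ∀ z : EuclideanSpace ℝ (Fin 3), ⟪z, EuclideanSpace.single (2 : Fin 3) (1:ℝ)⟫_ℝ = z 2 := by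
    intro z; rw [sp_inner_fin3]; simp
  have hw1' : ∀ τ, w 1 τ = w 0 τ := fun τ => by rw [hw1]
  intro u v hu hv
  obtain ⟨hwdef, htan⟩ := hdyn u v hu hv
  have hvX : ∀ τ, v (X 1 τ) 0 = -v (X 0 τ) 0 ∧ v (X 1 τ) 1 = -v (X 0 τ) 1 ∧ v (X 1 τ) 2 = v (X 0 τ) 2 :=
    fun τ => field_halfTurn hsym hd hint hu hv (X 0 τ) (X 1 τ) (hsym τ)
  refine ⟨hα, fun _ => hγ, ?_, ?_, ?_, ?_, ?_, ?_, ?_, ?_, ⟨hbox.1, hbox.2.1, fun _ => ⟨hbox.2.2.1, hbox.2.2.2⟩⟩, ?_⟩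
  · -- regularity, unit speed, curvature, properness
    refine Fin.forall_fin_two.mpr ⟨⟨hC, hwd, hunit, hcurv, hprop⟩, hC1, by rw [hw1]; exact hwd, fun τ => ?_, fun τ => ?_, ?_⟩
    · rw [norm_eq_of_halfTurn (hder τ)]; exact hunit τ
    · have h2 : ‖iteratedDeriv 2 (X 1) τ‖ = ‖iteratedDeriv 2 (X 0) τ‖ := by
        rw [hit 1, hit 0]; exact norm_eq_of_halfTurn (hdd τ)
      rw [h2]; exact hcurv τ
    · have h2 : (fun τ => ‖X 1 τ‖) = fun τ => ‖X 0 τ‖ := funext hn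
      rw [h2]; exact hprop
  · -- separation
    refine Fin.forall_fin_two.mpr ⟨Fin.forall_fin_two.mpr ⟨fun h => absurd rfl h, fun _ τ σ => hsep τ σ⟩,
      Fin.forall_fin_two.mpr ⟨fun _ τ σ => ?_, fun h => absurd rfl h⟩⟩
    rw [(hnd τ σ).2]; exact hsep τ σ
  · -- chord–arc
    refine Fin.forall_fin_two.mpr ⟨hca, fun τ σ h => ?_⟩
    rw [(hnd τ σ).1]; exact hca τ σ h
  · -- escape
    refine Fin.forall_fin_two.mpr ⟨hesc, fun τ => ?_⟩
    rw [hc1, hn τ]; exact hesc τ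
  · -- slip definition
    refine Fin.forall_fin_two.mpr ⟨hwdef, fun τ => ?_⟩
    rw [hw1' τ, hwdef τ, sp_inner_fin3, sp_inner_fin3, (hvX τ).1, (hvX τ).2.1, (hvX τ).2.2, (hder τ).1, (hder τ).2.1,
      (hder τ).2.2]
    ring
  · -- exact tangency on the ball
    refine Fin.forall_fin_two.mpr ⟨htan, fun τ hball => ?_⟩
    have hball0 : ‖X 0 τ‖ ≤ Rb*√(Γ*Real.log Γ) := by rw [← hn τ]; exact hball
    have h0 := htan τ hball0
    have h0i : ∀ i, v (X 0 τ) i = w 0 τ * deriv (X 0) τ i := by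
      intro i; rw [h0, PiLp.smul_apply, smul_eq_mul]
    ext i
    rw [PiLp.smul_apply, smul_eq_mul, hw1' τ]
    fin_cases i
    · show v (X 1 τ) 0 = w 0 τ * deriv (X 1) τ 0
      rw [(hvX τ).1, (hder τ).1, h0i 0]; ring
    · show v (X 1 τ) 1 = w 0 τ * deriv (X 1) τ 1
      rw [(hvX τ).2.1, (hder τ).2.1, h0i 1]; ring
    · show v (X 1 τ) 2 = w 0 τ * deriv (X 1) τ 2
      rw [(hvX τ).2.2, (hder τ).2.2, h0i 2]
  · -- waist
    refine Fin.forall_fin_two.mpr ⟨hwaist, ?_⟩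
    rw [hc1, hn]; exact hwaist
  · -- tilt
    refine Fin.forall_fin_two.mpr ⟨htilt, ?_⟩
    rw [hc1, hin, (hder (c 0)).2.2, ← hin]; exact htilt
  · -- zero clause
    refine Fin.forall_fin_two.mpr ⟨hzero, ?_⟩
    rw [hw1, hc1]; exact hzero


/-! ## §4 The parent crux from ONE curve in the symmetric class -/

/-- ★ **`SkeletonJ1L` BY NAME from a ONE-CURVE `R_π`-symmetric core family and the clause-13 child.**  HYPOTHESIS `hfam`: box constants
(`2Kρ ≤ 1`, `Λ ≥ 1`, the `θ₀`-box containing `α = 875/432`, `γ = 125π/108`), `Rb₁ > 0`, and for all `0 < Rb ≤ Rb₁`, all large `Γ`: a pair `X` in the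
half-turn class (only `X 0` is free), a slip `w₀` and a zero `cc` with — for filament `0` ONLY — `C²` unit speed, curvature `≤ K/√Γ`, properness,
separation from the image strand, chord–arc, escape, waist, tilt, the zero clause, tangent oscillation `≤ Rb`, `|w₀′| ≤ Λ`, the integrability clause,
and the two dynamic clauses for the pair's unit-core field.  With `Theses.Clause13NearStraightL` this gives the parent. [folklore] -/
theorem skeletonJ1L_of_halfTurnSymmetricCore
    (hfam : ∃ (δ ρ K Λ Rw cg θ₀ Rb₁ : ℝ), 0 < δ ∧ 0 < ρ ∧ 0 < Rw ∧ 0 < cg ∧ 0 < θ₀ ∧ 0 < Rb₁ ∧ 2 * K * ρ ≤ 1 ∧ 1 ≤ Λ ∧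
      (θ₀ ≤ |(875/432 : ℝ)| ∧ |(875/432 : ℝ)| ≤ θ₀⁻¹ ∧ θ₀ ≤ |(125 * Real.pi / 108 : ℝ)| ∧ |(125 * Real.pi / 108 : ℝ)| ≤ θ₀⁻¹) ∧
      ∀ Rb : ℝ, 0 < Rb → Rb ≤ Rb₁ → ∃ Γ₂ : ℝ, ∀ Γ : ℝ, Γ₂ ≤ Γ →
        ∃ (X : Fin 2 → ℝ → EuclideanSpace ℝ (Fin 3)) (w₀ : ℝ → ℝ) (cc : ℝ),
          (∀ σ, X 1 σ 0 = -X 0 σ 0 ∧ X 1 σ 1 = -X 0 σ 1 ∧ X 1 σ 2 = X 0 σ 2) ∧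
          (∀ k (x : EuclideanSpace ℝ (Fin 3)), Integrable (fun σ : ℝ =>
            ((‖x - X k σ‖ ^ 2 + Real.exp (-(1+Real.eulerMascheroniConstant-Real.log 2))) ^ (3 / 2 : ℝ))⁻¹ • cross (deriv (X k) σ) (x - X k σ))) ∧
          ContDiff ℝ 2 (X 0) ∧ Differentiable ℝ w₀ ∧ (∀ τ, ‖deriv (X 0) τ‖ = 1) ∧ (∀ τ, ‖iteratedDeriv 2 (X 0) τ‖*√Γ≤K) ∧
          Tendsto (fun τ => ‖X 0 τ‖) (cocompact ℝ) atTop ∧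
          (∀ τ σ, ρ*√Γ ≤ ‖X 0 τ - X 1 σ‖) ∧ (∀ τ σ, ρ*√Γ≤|τ-σ| → cg*ρ*√Γ≤‖X 0 τ-X 0 σ‖) ∧
          (∀ τ, cg*|τ-cc|≤Rw*√Γ+‖X 0 τ‖) ∧ ‖X 0 cc‖≤Rw*√Γ ∧ |⟪deriv (X 0) cc, EuclideanSpace.single 2 1⟫_ℝ|≤1-θ₀ ∧
          (w₀ cc = 0 ∧ (∀ τ, w₀ τ = 0 → τ = cc) ∧ 3/2+δ≤deriv w₀ cc ∧ deriv w₀ cc≤Λ) ∧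
          (∀ τ σ, ‖deriv (X 0) τ - deriv (X 0) σ‖ ≤ Rb) ∧ (∀ τ, |deriv w₀ τ| ≤ Λ) ∧
          (∀ (u : (Fin 2 → ℝ → EuclideanSpace ℝ (Fin 3)) → EuclideanSpace ℝ (Fin 3) → EuclideanSpace ℝ (Fin 3))
            (v : EuclideanSpace ℝ (Fin 3) → EuclideanSpace ℝ (Fin 3)),
            (∀ Z y, u Z y = ∑ k, (Γ*((fun _ : Fin 2 => 125 * Real.pi / 108) k)/(4*Real.pi))•∫ σ:ℝ, ((‖y-Z k σ‖^2+Real.exp (-(1+Real.eulerMascheroniConstant-Real.log 2)))^(3/2:ℝ))⁻¹•cross (deriv (Z k) σ) (y-Z k σ)) →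
            (∀ y, v y = u X y+(1/2:ℝ)•y-(875/432 : ℝ)•cross (EuclideanSpace.single 2 1) y) →
            (∀ τ, w₀ τ = ⟪v (X 0 τ), deriv (X 0) τ⟫_ℝ) ∧ (∀ τ, ‖X 0 τ‖≤Rb*√(Γ*Real.log Γ) → v (X 0 τ) = w₀ τ•deriv (X 0) τ)))
    (h3 : Summit.NavierStokesRegularity.NavierStokesRegularity.Theses.FilamentSkeletonRss.Clause13NearStraightL) :
    Summit.NavierStokesRegularity.NavierStokesRegularity.Theses.FilamentSkeletonRss.SkeletonJ1L := by
  obtain ⟨δ, ρ, K, Λ, Rw, cg, θ₀, Rb₁, hδ, hρ, hRw, hcg, hθ₀, hRb₁, hKρ, hΛ, hbox, hfam⟩ := hfam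
  refine skeletonJ1L_of_pairCurveCore ⟨δ, ρ, K, Λ, Rw, cg, θ₀, Rb₁, hδ, hρ, hRw, hcg, hθ₀, hRb₁, hKρ, hΛ, ?_⟩ h3
  intro Rb hRb hRb1
  obtain ⟨Γ₂, hΓ⟩ := hfam Rb hRb hRb1
  refine ⟨Γ₂, fun Γ hΓ2 => ?_⟩
  obtain ⟨X, w₀, cc, hsym, hint, hC, hwd, hunit, hcurv, hprop, hsep, hca, hesc, hwaist, htilt, hzero, hosc, hw', hdyn⟩ := hΓ Γ hΓ2
  have hα : (875/432 : ℝ) ≠ 0 := by norm_num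
  have hγ : (125 * Real.pi / 108 : ℝ) ≠ 0 := by positivity
  have hd : ∀ k, Differentiable ℝ (X k) :=
    Fin.forall_fin_two.mpr ⟨hC.differentiable (by norm_num), (contDiff_halfTurn hsym hC).differentiable (by norm_num)⟩
  refine ⟨X, fun _ => w₀, fun _ => cc, ?_, ?_, fun _ τ => hw' τ⟩
  · exact pairClauses_of_halfTurnSymmetric (w := fun _ => w₀) (c := fun _ => cc) hsym rfl rfl hint hα hγ hC hwd hunit hcurv hprop
      hsep hca hesc hwaist htilt ⟨hbox.1, hbox.2.1, hbox.2.2.1, hbox.2.2.2⟩ hzero hdyn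
  · refine Fin.forall_fin_two.mpr ⟨hosc, fun τ σ => ?_⟩
    rw [(norm_sub_eq_of_halfTurn (deriv_halfTurn hsym hd τ) (deriv_halfTurn hsym hd σ)).1]
    exact hosc τ σ


/-! ## §5 (appended, same hand) The MINIMAL one-curve core: chord–arc, escape, properness and integrability are automatic in the near-straight class -/

/-- Linear growth from the escape clause: `(7/8)|u| − ((7/8)|cc| + R) ≤ ‖X u‖`. [folklore] -/
theorem linear_growth_of_escape {X : ℝ → EuclideanSpace ℝ (Fin 3)} {cc R : ℝ} (hesc : ∀ τ, 7 / 8 * |τ - cc| ≤ R + ‖X τ‖) (u : ℝ) :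
    7 / 8 * |u| - (7 / 8 * |cc| + R) ≤ ‖X u‖ := by
  linarith [hesc u, abs_sub_abs_le_abs_sub u cc]

/-- The unit-core constant is a square: `exp(−(1+γ_E−log 2)) = exp(−(1+γ_E−log 2)/2)²`. [folklore] -/
theorem unitCore_eq_sq : Real.exp (-(1+Real.eulerMascheroniConstant-Real.log 2)) = Real.exp (-(1+Real.eulerMascheroniConstant-Real.log 2) / 2) ^ 2 := by
  rw [sq, ← Real.exp_add]; ring_nf

/-- ★ **`SkeletonJ1L` BY NAME from the MINIMAL one-curve `R_π`-symmetric core.**  As `skeletonJ1L_of_halfTurnSymmetricCore`, with the chord–arc, escape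
and properness clauses DERIVED (`cg := 7/8`, `Theorems.NearStraightGeometry`, from unit speed + tangent oscillation `≤ Rb ≤ ½` + the waist) and the
integrability clause DERIVED (`Theorems.SkeletonEquilibrium.Sketch.stub_kernelIntegrable`, from `C¹` + `‖X′‖ ≤ 1` + linear growth).  What the family must
supply for filament `0`: `C²` unit speed, curvature `≤ K/√Γ`, tangent oscillation `≤ Rb`, waist `‖X₀(cc)‖ ≤ Rw√Γ`, tilt, separation from `R_π X₀`, a
differentiable slip `w₀` with the zero clause and `|w₀′| ≤ Λ`, and the two dynamic clauses for the pair's unit-core field. [folklore] -/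
theorem skeletonJ1L_of_halfTurnSymmetricCoreMin
    (hfam : ∃ (δ ρ K Λ Rw θ₀ Rb₁ : ℝ), 0 < δ ∧ 0 < ρ ∧ 0 < Rw ∧ 0 < θ₀ ∧ 0 < Rb₁ ∧ Rb₁ ≤ 1 / 2 ∧ 2 * K * ρ ≤ 1 ∧ 1 ≤ Λ ∧
      (θ₀ ≤ |(875/432 : ℝ)| ∧ |(875/432 : ℝ)| ≤ θ₀⁻¹ ∧ θ₀ ≤ |(125 * Real.pi / 108 : ℝ)| ∧ |(125 * Real.pi / 108 : ℝ)| ≤ θ₀⁻¹) ∧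
      ∀ Rb : ℝ, 0 < Rb → Rb ≤ Rb₁ → ∃ Γ₂ : ℝ, ∀ Γ : ℝ, Γ₂ ≤ Γ →
        ∃ (X : Fin 2 → ℝ → EuclideanSpace ℝ (Fin 3)) (w₀ : ℝ → ℝ) (cc : ℝ),
          (∀ σ, X 1 σ 0 = -X 0 σ 0 ∧ X 1 σ 1 = -X 0 σ 1 ∧ X 1 σ 2 = X 0 σ 2) ∧
          ContDiff ℝ 2 (X 0) ∧ Differentiable ℝ w₀ ∧ (∀ τ, ‖deriv (X 0) τ‖ = 1) ∧ (∀ τ, ‖iteratedDeriv 2 (X 0) τ‖*√Γ≤K) ∧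
          (∀ τ σ, ρ*√Γ ≤ ‖X 0 τ - X 1 σ‖) ∧ ‖X 0 cc‖≤Rw*√Γ ∧ |⟪deriv (X 0) cc, EuclideanSpace.single 2 1⟫_ℝ|≤1-θ₀ ∧
          (w₀ cc = 0 ∧ (∀ τ, w₀ τ = 0 → τ = cc) ∧ 3/2+δ≤deriv w₀ cc ∧ deriv w₀ cc≤Λ) ∧
          (∀ τ σ, ‖deriv (X 0) τ - deriv (X 0) σ‖ ≤ Rb) ∧ (∀ τ, |deriv w₀ τ| ≤ Λ) ∧
          (∀ (u : (Fin 2 → ℝ → EuclideanSpace ℝ (Fin 3)) → EuclideanSpace ℝ (Fin 3) → EuclideanSpace ℝ (Fin 3))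
            (v : EuclideanSpace ℝ (Fin 3) → EuclideanSpace ℝ (Fin 3)),
            (∀ Z y, u Z y = ∑ k, (Γ*((fun _ : Fin 2 => 125 * Real.pi / 108) k)/(4*Real.pi))•∫ σ:ℝ, ((‖y-Z k σ‖^2+Real.exp (-(1+Real.eulerMascheroniConstant-Real.log 2)))^(3/2:ℝ))⁻¹•cross (deriv (Z k) σ) (y-Z k σ)) →
            (∀ y, v y = u X y+(1/2:ℝ)•y-(875/432 : ℝ)•cross (EuclideanSpace.single 2 1) y) →
            (∀ τ, w₀ τ = ⟪v (X 0 τ), deriv (X 0) τ⟫_ℝ) ∧ (∀ τ, ‖X 0 τ‖≤Rb*√(Γ*Real.log Γ) → v (X 0 τ) = w₀ τ•deriv (X 0) τ)))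
    (h3 : Summit.NavierStokesRegularity.NavierStokesRegularity.Theses.FilamentSkeletonRss.Clause13NearStraightL) :
    Summit.NavierStokesRegularity.NavierStokesRegularity.Theses.FilamentSkeletonRss.SkeletonJ1L := by
  obtain ⟨δ, ρ, K, Λ, Rw, θ₀, Rb₁, hδ, hρ, hRw, hθ₀, hRb₁, hRbh, hKρ, hΛ, hbox, hfam⟩ := hfam
  refine skeletonJ1L_of_halfTurnSymmetricCore ⟨δ, ρ, K, Λ, Rw, 7 / 8, θ₀, Rb₁, hδ, hρ, hRw, by norm_num, hθ₀, hRb₁, hKρ, hΛ, hbox, ?_⟩ h3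
  intro Rb hRb hRb1
  obtain ⟨Γ₂, hΓ⟩ := hfam Rb hRb hRb1
  refine ⟨Γ₂, fun Γ hΓ2 => ?_⟩
  obtain ⟨X, w₀, cc, hsym, hC, hwd, hunit, hcurv, hsep, hwaist, htilt, hzero, hosc, hw', hdyn⟩ := hΓ Γ hΓ2
  have hRb2 : Rb ≤ 1 / 2 := hRb1.trans hRbh
  have hC1 : ContDiff ℝ 2 (X 1) := contDiff_halfTurn hsym hC
  have hCk : ∀ k, ContDiff ℝ 2 (X k) := Fin.forall_fin_two.mpr ⟨hC, hC1⟩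
  have hd : ∀ k, Differentiable ℝ (X k) := fun k => (hCk k).differentiable (by norm_num)
  have hder := fun τ => deriv_halfTurn hsym hd τ
  have hn : ∀ τ, ‖X 1 τ‖ = ‖X 0 τ‖ := fun τ => norm_eq_of_halfTurn (hsym τ)
  have hunit1 : ∀ τ, ‖deriv (X 1) τ‖ = 1 := fun τ => by rw [norm_eq_of_halfTurn (hder τ)]; exact hunit τ
  -- geometry block for free (cg = 7/8)
  have hesc : ∀ τ, 7 / 8 * |τ - cc| ≤ Rw * √Γ + ‖X 0 τ‖ :=
    fun τ => NearStraightGeometry.escape_of_nearStraight (hd 0) hunit hosc hRb2 hwaist τ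
  have hca : ∀ τ σ, ρ*√Γ≤|τ-σ| → 7 / 8 *ρ*√Γ≤‖X 0 τ-X 0 σ‖ := by
    intro τ σ h
    have := NearStraightGeometry.chordArc_of_nearStraight (hd 0) hunit hosc hRb2 τ σ h
    linarith
  have hprop := NearStraightGeometry.tendsto_norm_of_nearStraight (hd 0) hunit hosc hRb2
  -- integrability of the unit-core kernel along both strands
  have hgrow : ∀ k u, 7 / 8 * |u| - (7 / 8 * |cc| + Rw * √Γ) ≤ ‖X k u‖ := by
    refine Fin.forall_fin_two.mpr ⟨linear_growth_of_escape hesc, fun u => ?_⟩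
    rw [hn u]; exact linear_growth_of_escape hesc u
  have hle : ∀ k u, ‖deriv (X k) u‖ ≤ 1 :=
    Fin.forall_fin_two.mpr ⟨fun u => (hunit u).le, fun u => (hunit1 u).le⟩
  have hint : ∀ k (x : EuclideanSpace ℝ (Fin 3)), Integrable (fun σ : ℝ =>
      ((‖x - X k σ‖ ^ 2 + Real.exp (-(1+Real.eulerMascheroniConstant-Real.log 2))) ^ (3 / 2 : ℝ))⁻¹ • cross (deriv (X k) σ) (x - X k σ)) := by
    intro k x
    have h := SkeletonEquilibrium.Sketch.stub_kernelIntegrable (Real.exp (-(1+Real.eulerMascheroniConstant-Real.log 2) / 2)) (7 / 8)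
      (7 / 8 * |cc| + Rw * √Γ) (X k) (Real.exp_pos _).ne' (by norm_num) ((hCk k).of_le (by norm_num)) (hle k) (hgrow k) x
    simp only [← unitCore_eq_sq] at h
    exact h
  exact ⟨X, w₀, cc, hsym, hint, hC, hwd, hunit, hcurv, hprop, hsep, hca, hesc, hwaist, htilt, hzero, hosc, hw', hdyn⟩

end Summit.NavierStokesRegularity.NavierStokesRegularity.Theorems.SkeletonJ1LSymmetricPair

end
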